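import Summits.AtomisticToContinuum.Crystallization.Theorems.FrustratedLawDichotomyCellTails
import Summits.AtomisticToContinuum.Crystallization.Theorems.FrustratedLawDichotomyCellClasses

/-!
# FrustratedLawDichotomy · crux `AperiodicFrustratedLawGap` (stmt-AtomisticToContinuum-27623) — CELL-SOUND XV: LABEL SYMMETRY OF A CELL
(cell decomp-a2c, lens-5 g113; answers hand-1's K-BUDGET ALARM on the per-label NASH block, crit r1792/r1794, census NASH-BLOCK NUMBERS)

The per-label columns of the master (251) `lb_le_certFloorL_trunc` — the NASH number `hnn`, the host-force pairing `hhf`, the far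
column `hfc` — cost one pair sum per label (≈ 1.3–6.5·10⁵ pair terms per cell).  They are EQUIVARIANT under any label symmetry of
the cell data: a label map `P` and a matrix `R` with `M·P = M`, `MI·P = MI`, near lists carried along, template `a ∘ P = R·a` and
multipliers `ω ∘ P = R·ω`.  Since `posL F (R v) = posL (F R) v` (§1), the value of every column at the label `P m` and cell point
`F` equals its value at `m` and `F R` (§3: `certCoeffNearL_symm`, `nashTerm_symm`, `hostPair_symm`, `farTerm_symm`), and a signed
permutation `R` maps the strain cell `|FᵀF − 1| ≤ ε` to itself (§4: `nearId_mul_spMat`).  Hence (§5) ★ `nn_of_reps` / `hf_of_reps` /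
`fc_of_reps`: a per-label bound proved for ORBIT REPRESENTATIVES uniformly over the cell gives the (251) row for every label — the
kernel reads `1/|Stab T|` of the pairs (F1 and every uniaxial cell 1/16, fcc 1/48, a generic cell 1/2).  §4 also gives the integer
facts that make the label sets invariant STRUCTURALLY (`image_eq_of_mapsTo`, `sumSq_spMatZ_mulVec`, `even_sum_spMatZ_mulVec_iff`,
`ballL_symm`), and §6 the translation identity for the own-multiplier sum (`linLab = lamMat·y`, `sum_linLab_eq`).

House conventions: SI units · italic scalars, bold vectors, sans-serif tensors · numbered formulae only when referenced · en-dash for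
ranges · References = cited works, numbered, alphabetical · no footnotes; Remarks at section ends · British spelling, -ise · Lennard-Jones
hyphenated; NASH capitalised as the Statement's notion · "folklore" tags standard bookkeeping; no new references are cited in this file.
-/

noncomputable section

namespace Summit.AtomisticToContinuum.Crystallization.Theorems.FrustratedLawDichotomyCellSymm

open scoped BigOperators
open RealInnerProductSpace
open Summit.AtomisticToContinuum.Crystallization.Theorems.ChargedEnergyGapNegative (E3)
open Summit.AtomisticToContinuum.Crystallization.Theorems.FrustratedLawDichotomyCoherentFloorAlgebra (psiT psiT1 ljBondForce
  ljBondForceLin)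
open Summit.AtomisticToContinuum.Crystallization.Theorems.FrustratedLawDichotomyCoherentFloor (farCol)
open Summit.AtomisticToContinuum.Crystallization.Theorems.FrustratedLawDichotomyCellTails (certCoeffNearL psiTail)
open Summit.AtomisticToContinuum.Crystallization.Theorems.FrustratedLawDichotomyCellMetric (posL gram linLab)
open Summit.AtomisticToContinuum.Crystallization.Theorems.FrustratedLawDichotomyCellClasses (ballL)

/-! ## §1. Placements compose with a label-space matrix -/

/-- `F (R v) = (F R) v` as placed vectors. [folklore] -/
theorem posL_mulVec_right (F R : Matrix (Fin 3) (Fin 3) ℝ) (v : Fin 3 → ℝ) : posL F (R.mulVec v) = posL (F * R) v := by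
  unfold posL
  rw [Matrix.mulVec_mulVec]

/-- the cast of an integer matrix action: `(R z : ℝ³) = (R : ℝ) (z : ℝ³)`. [folklore] -/
theorem cast_mulVec (Rz : Matrix (Fin 3) (Fin 3) ℤ) (z : Fin 3 → ℤ) :
    (fun j => ((Rz.mulVec z) j : ℝ)) = (Rz.map fun t : ℤ => (t : ℝ)).mulVec fun j => (z j : ℝ) := by
  funext j
  have := RingHom.map_mulVec (Int.castRingHom ℝ) Rz z j
  simpa [Function.comp_def] using this

/-- ★ TEMPLATE EQUIVARIANCE from one commutation: `T (R z) = R (T z)` when `T R = R T`. [folklore] -/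
theorem template_equivar (T : Matrix (Fin 3) (Fin 3) ℝ) (Rz : Matrix (Fin 3) (Fin 3) ℤ)
    (hTR : T * Rz.map (fun t : ℤ => (t : ℝ)) = Rz.map (fun t : ℤ => (t : ℝ)) * T) (z : Fin 3 → ℤ) :
    T.mulVec (fun j => ((Rz.mulVec z) j : ℝ)) = (Rz.map fun t : ℤ => (t : ℝ)).mulVec (T.mulVec fun j => (z j : ℝ)) := by
  rw [cast_mulVec, Matrix.mulVec_mulVec, Matrix.mulVec_mulVec, hTR]

/-! ## §2. Reindexing the near lists under a label symmetry -/

section Labels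

variable {ι : Type*} [DecidableEq ι]

/-- membership transport through `S·P = S`. [folklore] -/
theorem mem_iff_of_image_eq {P : ι → ι} (hP : Function.Injective P) {S : Finset ι} (hS : S.image P = S) (x : ι) :
    P x ∈ S ↔ x ∈ S := by
  refine ⟨fun h => ?_, fun h => by rw [← hS]; exact Finset.mem_image_of_mem P h⟩
  rw [← hS] at h
  obtain ⟨x', hx', he⟩ := Finset.mem_image.mp h
  rwa [← hP he]

/-- ★ INVARIANCE WITHOUT ENUMERATION: an injective map sending a finite set into itself fixes it — so `M·P = M` follows from the
STRUCTURAL fact `∀ x ∈ M, P x ∈ M` (cube bound + parity + radius, §4), never from comparing two lists of 14 000 labels. [folklore] -/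
theorem image_eq_of_mapsTo {P : ι → ι} (hP : Function.Injective P) {S : Finset ι} (h : ∀ x ∈ S, P x ∈ S) : S.image P = S :=
  Finset.eq_of_subset_of_card_le (Finset.image_subset_iff.mpr h) (by rw [Finset.card_image_of_injective S hP])

/-- the erase-filter sets of (250)/(251) are carried along: `{x ∈ S ∖ P m : x ∈ L'} = P {x ∈ S ∖ m : x ∈ L}` when `L' = P L`.
[folklore] -/
theorem filter_erase_image {P : ι → ι} (hP : Function.Injective P) {S : Finset ι} (hS : S.image P = S) {L L' : Finset ι}
    (hL : L' = L.image P) (m : ι) :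
    (S.erase (P m)).filter (fun x => x ∈ L') = ((S.erase m).filter fun x => x ∈ L).image P := by
  ext x
  simp only [Finset.mem_filter, Finset.mem_erase, Finset.mem_image, hL]
  constructor
  · rintro ⟨⟨hne, hxS⟩, ⟨x', hx'L, rfl⟩⟩
    exact ⟨x', ⟨⟨fun h => hne (by rw [h]), (mem_iff_of_image_eq hP hS x').mp hxS⟩, hx'L⟩, rfl⟩
  · rintro ⟨x', ⟨⟨hne, hx'S⟩, hx'L⟩, rfl⟩
    exact ⟨⟨fun h => hne (hP h), (mem_iff_of_image_eq hP hS x').mpr hx'S⟩, x', hx'L, rfl⟩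

/-! ## §3. ★ Equivariance of the per-label columns under ONE label symmetry `(P, pos ↦ pos')` -/

section OneSymmetry

variable {M MI : Finset ι} {pos pos' Y Y' : ι → E3} {nb nbh : ι → Finset ι} {P : ι → ι}

/-- ★ the near NASH coefficient (250) `certCoeffNearL` at `P m` in the data `(pos, Y)` is the coefficient at `m` in the transported data
`(pos', Y') = (pos ∘ P, Y ∘ P)`. [folklore] -/
theorem certCoeffNearL_symm (hP : Function.Injective P) (hM : M.image P = M) (hMI : MI.image P = MI) (hMIM : MI ⊆ M)
    (hnb : ∀ m ∈ M, nb (P m) = (nb m).image P) (hpos : ∀ x ∈ M, pos (P x) = pos' x) (hY : ∀ x ∈ MI, Y (P x) = Y' x)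
    {m : ι} (hm : m ∈ M) :
    certCoeffNearL M MI pos Y nb (P m) = certCoeffNearL M MI pos' Y' nb m := by
  unfold certCoeffNearL
  rw [filter_erase_image hP hM (hnb m hm) m, filter_erase_image hP hMI (hnb m hm) m,
    Finset.sum_image fun x _ y _ h => hP h, Finset.sum_image fun x _ y _ h => hP h]
  congr 1
  · by_cases h : m ∈ MI
    · rw [if_pos ((mem_iff_of_image_eq hP hMI m).mpr h), if_pos h]
      refine Finset.sum_congr rfl fun x hx => ?_
      have hxM : x ∈ M := Finset.mem_of_mem_erase (Finset.mem_filter.mp hx).1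
      rw [hpos m hm, hpos x hxM, hY m h]
    · rw [if_neg fun h' => h ((mem_iff_of_image_eq hP hMI m).mp h'), if_neg h]
  · refine Finset.sum_congr rfl fun x hx => ?_
    have hxMI : x ∈ MI := Finset.mem_of_mem_erase (Finset.mem_filter.mp hx).1
    rw [hpos m hm, hpos x (hMIM hxMI), hY x hxMI]

/-- ★ the (251) `hnn` term transports. [folklore] -/
theorem nashTerm_symm (hP : Function.Injective P) (hM : M.image P = M) (hMI : MI.image P = MI) (hMIM : MI ⊆ M)
    (hnb : ∀ m ∈ M, nb (P m) = (nb m).image P) (hpos : ∀ x ∈ M, pos (P x) = pos' x) (hY : ∀ x ∈ MI, Y (P x) = Y' x)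
    {m : ι} (hm : m ∈ M) :
    ‖psiT (‖pos (P m)‖ ^ 2) • pos (P m) - certCoeffNearL M MI pos Y nb (P m)‖
      = ‖psiT (‖pos' m‖ ^ 2) • pos' m - certCoeffNearL M MI pos' Y' nb m‖ := by
  rw [certCoeffNearL_symm hP hM hMI hMIM hnb hpos hY hm, hpos m hm]

/-- ★ the (251) `hhf` term (host-force pairing of an interior label) transports. [folklore] -/
theorem hostPair_symm (hP : Function.Injective P) (hM : M.image P = M) (hMIM : MI ⊆ M)
    (hnbh : ∀ m ∈ MI, nbh (P m) = (nbh m).image P) (hpos : ∀ x ∈ M, pos (P x) = pos' x) (hY : ∀ x ∈ MI, Y (P x) = Y' x)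
    {m : ι} (hm : m ∈ MI) (t : ℝ) :
    ⟪Y (P m), ∑ m' ∈ (M.erase (P m)).filter (fun m' => m' ∈ nbh (P m)), ljBondForce (pos (P m) - pos m')⟫ + ‖Y (P m)‖ * t
      = ⟪Y' m, ∑ m' ∈ (M.erase m).filter (fun m' => m' ∈ nbh m), ljBondForce (pos' m - pos' m')⟫ + ‖Y' m‖ * t := by
  rw [filter_erase_image hP hM (hnbh m hm) m, Finset.sum_image fun x _ y _ h => hP h, hY m hm, hpos m (hMIM hm)]
  congr 2
  refine Finset.sum_congr rfl fun x hx => ?_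
  rw [hpos x (Finset.mem_of_mem_erase (Finset.mem_filter.mp hx).1)]

omit [DecidableEq ι] in
/-- the (251) `hfc` term transports. [folklore] -/
theorem farTerm_symm (hMIM : MI ⊆ M) (hpos : ∀ x ∈ M, pos (P x) = pos' x) (hY : ∀ x ∈ MI, Y (P x) = Y' x)
    {m : ι} (hm : m ∈ MI) (Rc τ : ℝ) :
    ‖Y (P m)‖ * farCol (Rc - (‖pos (P m)‖ + τ)) = ‖Y' m‖ * farCol (Rc - (‖pos' m‖ + τ)) := by
  rw [hY m hm, hpos m (hMIM hm)]

end OneSymmetry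

end Labels

/-! ## §4. Signed permutation matrices: the strain cell is invariant, and the integer label facts -/

/-- an injective self-map of `Fin 3` hits every index. [folklore] -/
theorem exists_eq_of_injective {p : Fin 3 → Fin 3} (hp : Function.Injective p) (i : Fin 3) : ∃ j, p j = i :=
  (Finite.injective_iff_bijective.mp hp).2 i

/-- reindexing a `Fin 3` sum along an injective self-map. [folklore] -/
theorem sum_comp_injective {α : Type*} [AddCommMonoid α] {p : Fin 3 → Fin 3} (hp : Function.Injective p) (f : Fin 3 → α) :
    ∑ j, f (p j) = ∑ i, f i :=
  Equiv.sum_comp (Equiv.ofBijective p (Finite.injective_iff_bijective.mp hp)) f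

/-- the SIGNED PERMUTATION MATRIX with column `j` equal to `s j · e_{p j}` (real). -/
def spMat (p : Fin 3 → Fin 3) (s : Fin 3 → ℝ) : Matrix (Fin 3) (Fin 3) ℝ := fun i j => if i = p j then s j else 0

/-- the same over `ℤ` (the K-files' group data). -/
def spMatZ (p : Fin 3 → Fin 3) (s : Fin 3 → ℤ) : Matrix (Fin 3) (Fin 3) ℤ := fun i j => if i = p j then s j else 0

/-- the cast `ℤ → ℝ`. [folklore] -/
theorem spMatZ_map (p : Fin 3 → Fin 3) (s : Fin 3 → ℤ) :
    (spMatZ p s).map (fun t : ℤ => (t : ℝ)) = spMat p fun j => (s j : ℝ) := by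
  ext i j
  simp only [spMatZ, spMat, Matrix.map_apply]
  split_ifs <;> simp

/-- `(F R)_{i j} = s_j · F_{i, p j}`. [folklore] -/
theorem mul_spMat_apply (F : Matrix (Fin 3) (Fin 3) ℝ) (p : Fin 3 → Fin 3) (s : Fin 3 → ℝ) (i j : Fin 3) :
    (F * spMat p s) i j = F i (p j) * s j := by
  simp only [Matrix.mul_apply, spMat, mul_ite, mul_zero, Finset.sum_ite_eq', Finset.mem_univ, if_true]

/-- the transported Gram matrix: `((F R)ᵀ(F R))_{j l} = s_j s_l (FᵀF)_{p j, p l}`. [folklore] -/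
theorem gramMat_mul_spMat (F : Matrix (Fin 3) (Fin 3) ℝ) (p : Fin 3 → Fin 3) (s : Fin 3 → ℝ) (j l : Fin 3) :
    ((F * spMat p s).transpose * (F * spMat p s)) j l = s j * s l * (F.transpose * F) (p j) (p l) := by
  rw [Matrix.mul_apply]
  simp only [Matrix.transpose_apply, mul_spMat_apply]
  rw [Matrix.mul_apply, Finset.mul_sum]
  refine Finset.sum_congr rfl fun i _ => ?_
  rw [Matrix.transpose_apply]
  ring

/-- ★ THE STRAIN CELL IS INVARIANT: `|FᵀF − 1| ≤ ε ⇒ |(F R)ᵀ(F R) − 1| ≤ ε` for a signed permutation `R = spMat p s` (`p` injective,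
`s = ±1`) — so a representative's bound «for all `F` in the cell» applies at `F R`. [folklore] -/
theorem nearId_mul_spMat {F : Matrix (Fin 3) (Fin 3) ℝ} {ε : ℝ} (hG : ∀ i j, |(F.transpose * F) i j - (if i = j then 1 else 0)| ≤ ε)
    {p : Fin 3 → Fin 3} (hp : Function.Injective p) {s : Fin 3 → ℝ} (hs : ∀ j, s j = 1 ∨ s j = -1) :
    ∀ i j, |((F * spMat p s).transpose * (F * spMat p s)) i j - (if i = j then 1 else 0)| ≤ ε := by
  intro j l
  rw [gramMat_mul_spMat]
  have habs : |s j * s l| = 1 := by rcases hs j with h | h <;> rcases hs l with h' | h' <;> rw [h, h'] <;> norm_num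
  by_cases hjl : j = l
  · subst hjl
    have h1 : s j * s j = 1 := by rcases hs j with h | h <;> rw [h] <;> norm_num
    simpa only [h1, one_mul, if_true] using hG (p j) (p j)
  · have h1 := hG (p j) (p l)
    rw [if_neg fun h => hjl (hp h), sub_zero] at h1
    rwa [if_neg hjl, sub_zero, abs_mul, habs, one_mul]

/-- the action on the `p j`-th coordinate: `(R z)_{p j} = s_j z_j`. [folklore] -/
theorem spMatZ_mulVec_at {p : Fin 3 → Fin 3} (hp : Function.Injective p) (s : Fin 3 → ℤ) (z : Fin 3 → ℤ) (j : Fin 3) :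
    (spMatZ p s).mulVec z (p j) = s j * z j := by
  simp only [Matrix.mulVec, dotProduct, spMatZ]
  have : ∀ j', (if p j = p j' then s j' else 0) * z j' = if j = j' then s j * z j else 0 := by
    intro j'
    by_cases h : j = j'
    · subst h; simp
    · rw [if_neg (fun h' => h (hp h')), if_neg h, zero_mul]
  simp only [this, Finset.sum_ite_eq, Finset.mem_univ, if_true]

/-- the label action `z ↦ R z` of a signed permutation is injective. [folklore] -/
theorem spMatZ_mulVec_injective {p : Fin 3 → Fin 3} (hp : Function.Injective p) {s : Fin 3 → ℤ} (hs : ∀ j, s j = 1 ∨ s j = -1) :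
    Function.Injective fun z : Fin 3 → ℤ => (spMatZ p s).mulVec z := by
  intro z z' h
  funext j
  have hj := congrFun h (p j)
  simp only [spMatZ_mulVec_at hp] at hj
  have hs1 : s j * s j = 1 := by rcases hs j with h | h <;> rw [h] <;> norm_num
  calc z j = s j * s j * z j := by rw [hs1, one_mul]
    _ = s j * (s j * z' j) := by rw [mul_assoc, hj]
    _ = z' j := by rw [← mul_assoc, hs1, one_mul]

/-- ★ `|R z|² = |z|²`: integer radii (`ballL`, class keys `|z|²`) are invariant. [folklore] -/
theorem sumSq_spMatZ_mulVec {p : Fin 3 → Fin 3} (hp : Function.Injective p) {s : Fin 3 → ℤ} (hs : ∀ j, s j = 1 ∨ s j = -1)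
    (z : Fin 3 → ℤ) : ∑ i, ((spMatZ p s).mulVec z i) ^ 2 = ∑ i, z i ^ 2 := by
  rw [← sum_comp_injective hp (fun i => ((spMatZ p s).mulVec z i) ^ 2)]
  refine Finset.sum_congr rfl fun j _ => ?_
  simp only [spMatZ_mulVec_at hp]
  rcases hs j with h | h <;> rw [h] <;> ring

/-- `|R z − R z'|² = |z − z'|²`. [folklore] -/
theorem sumSq_sub_spMatZ_mulVec {p : Fin 3 → Fin 3} (hp : Function.Injective p) {s : Fin 3 → ℤ} (hs : ∀ j, s j = 1 ∨ s j = -1)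
    (z z' : Fin 3 → ℤ) : ∑ i, ((spMatZ p s).mulVec z i - (spMatZ p s).mulVec z' i) ^ 2 = ∑ i, (z i - z' i) ^ 2 := by
  have : ∀ i, (spMatZ p s).mulVec z i - (spMatZ p s).mulVec z' i = (spMatZ p s).mulVec (z - z') i := by
    intro i; rw [Matrix.mulVec_sub]; rfl
  simp only [this, sumSq_spMatZ_mulVec hp hs]
  rfl

/-- ★ PARITY is invariant: `Σ (R z)_i ≡ Σ z_i (mod 2)` — the fcc parity frame is carried to itself. [folklore] -/
theorem even_sum_spMatZ_mulVec_iff {p : Fin 3 → Fin 3} (hp : Function.Injective p) {s : Fin 3 → ℤ} (hs : ∀ j, s j = 1 ∨ s j = -1)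
    (z : Fin 3 → ℤ) : Even (∑ i, (spMatZ p s).mulVec z i) ↔ Even (∑ i, z i) := by
  rw [← sum_comp_injective hp (fun i => (spMatZ p s).mulVec z i)]
  simp only [spMatZ_mulVec_at hp]
  have hd : Even (∑ j, s j * z j - ∑ j, z j) := by
    rw [← Finset.sum_sub_distrib]
    refine Finset.even_sum _ fun j _ => ?_
    rcases hs j with h | h
    · rw [h, one_mul, sub_self]; exact Even.zero
    · rw [h]; exact ⟨-z j, by ring⟩
  exact ⟨fun h => by simpa using h.sub hd, fun h => by simpa using hd.add h⟩

/-- the coordinate cube is invariant: `|z_i| ≤ N ∀ i ⇒ |(R z)_i| ≤ N ∀ i`. [folklore] -/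
theorem abs_spMatZ_mulVec_le {p : Fin 3 → Fin 3} (hp : Function.Injective p) {s : Fin 3 → ℤ} (hs : ∀ j, s j = 1 ∨ s j = -1)
    {z : Fin 3 → ℤ} {N : ℤ} (hz : ∀ i, |z i| ≤ N) : ∀ i, |(spMatZ p s).mulVec z i| ≤ N := by
  intro i
  obtain ⟨j, rfl⟩ := exists_eq_of_injective hp i
  rw [spMatZ_mulVec_at hp, abs_mul]
  have : |s j| = 1 := by rcases hs j with h | h <;> rw [h] <;> norm_num
  rw [this, one_mul]
  exact hz j

/-- an integer quadratic form `zᵀA z` is invariant under `R` once `RᵀA R = A` (decided once per group element; for the K-files' forms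
`Q(z) = q₁z₀² + q₂(z₁² + z₂²)` and the sixteen signed permutations fixing the axis this is immediate). [folklore] -/
theorem quadForm_invariant (A Rz : Matrix (Fin 3) (Fin 3) ℤ) (hA : Rz.transpose * A * Rz = A) (z : Fin 3 → ℤ) :
    dotProduct (Rz.mulVec z) (A.mulVec (Rz.mulVec z)) = dotProduct z (A.mulVec z) := by
  conv_rhs => rw [← hA, ← Matrix.mulVec_mulVec, ← Matrix.mulVec_mulVec, Matrix.dotProduct_mulVec z, Matrix.vecMul_transpose]

section LabelSets

variable {ι : Type*} [DecidableEq ι]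

/-- ★ the integer-radius balls (261) `ballL` are carried along: `ballL M z ℓ (P c) = P (ballL M z ℓ c)` when `P M = M` and `P`
preserves `|Δz|²` (signed permutations: `sumSq_sub_spMatZ_mulVec`). [folklore] -/
theorem ballL_symm {P : ι → ι} (hP : Function.Injective P) {M : Finset ι} (hM : M.image P = M) {z : ι → Fin 3 → ℤ}
    (hz : ∀ x y, ∑ i, (z (P x) i - z (P y) i) ^ 2 = ∑ i, (z x i - z y i) ^ 2) (ℓ : ℤ) (c : ι) :
    ballL M z ℓ (P c) = (ballL M z ℓ c).image P := by
  ext x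
  simp only [ballL, Finset.mem_filter, Finset.mem_image]
  constructor
  · rintro ⟨hxM, hlt⟩
    rw [← hM] at hxM
    obtain ⟨x', hx'M, rfl⟩ := Finset.mem_image.mp hxM
    exact ⟨x', ⟨hx'M, by rwa [hz] at hlt⟩, rfl⟩
  · rintro ⟨x', ⟨hx'M, hlt⟩, rfl⟩
    exact ⟨(mem_iff_of_image_eq hP hM x').mpr hx'M, by rwa [hz]⟩

end LabelSets

/-! ## §5. ★ Per-label rows from ORBIT REPRESENTATIVES -/

section Reps

variable {ι : Type*} [DecidableEq ι] {κ : Type*} {B : Set (Matrix (Fin 3) (Fin 3) ℝ)} {Rr : κ → Matrix (Fin 3) (Fin 3) ℝ}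
  {Pk : κ → ι → ι} {M MI MN Reps : Finset ι} {a ω : ι → Fin 3 → ℝ} {nb nbh : ι → Finset ι} {symOf : ι → κ} {rep : ι → ι}

/-- ★★ THE NASH ROW FROM REPRESENTATIVES.  Data: a family of label symmetries `(Pk k, Rr k)` of the cell (the stabiliser of the template
in the signed-permutation group), a representative map `rep` and an index map `symOf` with `Pk (symOf m) (rep m) = m` on `MN`.  If the
per-label NASH bound holds for the representatives UNIFORMLY OVER THE CELL `B` (`hrep`, the expensive kernel readings) and `B·R ⊆ B`
(`nearId_mul_spMat`), then the (251) `hnn` row holds for every label at every `F ∈ B` with the number `nnTab (rep m)`. [folklore] -/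
theorem nn_of_reps (hB : ∀ k, ∀ F ∈ B, F * Rr k ∈ B) (hP : ∀ k, Function.Injective (Pk k)) (hM : ∀ k, M.image (Pk k) = M)
    (hMI : ∀ k, MI.image (Pk k) = MI) (hMIM : MI ⊆ M) (hnb : ∀ k, ∀ m ∈ M, nb (Pk k m) = (nb m).image (Pk k))
    (ha : ∀ k, ∀ x ∈ M, a (Pk k x) = (Rr k).mulVec (a x)) (hω : ∀ k, ∀ x ∈ MI, ω (Pk k x) = (Rr k).mulVec (ω x))
    (hReps : Reps ⊆ M) (hcov : ∀ m ∈ MN, rep m ∈ Reps ∧ Pk (symOf m) (rep m) = m) (nnTab : ι → ℝ)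
    (hrep : ∀ F ∈ B, ∀ m₀ ∈ Reps, ‖psiT (‖posL F (a m₀)‖ ^ 2) • posL F (a m₀)
        - certCoeffNearL M MI (fun x => posL F (a x)) (fun x => posL F (ω x)) nb m₀‖ ≤ nnTab m₀) :
    ∀ F ∈ B, ∀ m ∈ MN, ‖psiT (‖posL F (a m)‖ ^ 2) • posL F (a m)
        - certCoeffNearL M MI (fun x => posL F (a x)) (fun x => posL F (ω x)) nb m‖ ≤ nnTab (rep m) := by
  intro F hF m hm
  obtain ⟨hr, hPm⟩ := hcov m hm
  have hpos : ∀ x ∈ M, posL F (a (Pk (symOf m) x)) = posL (F * Rr (symOf m)) (a x) := fun x hx => by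
    rw [ha _ x hx, posL_mulVec_right]
  have hY : ∀ x ∈ MI, posL F (ω (Pk (symOf m) x)) = posL (F * Rr (symOf m)) (ω x) := fun x hx => by
    rw [hω _ x hx, posL_mulVec_right]
  have h := nashTerm_symm (pos := fun x => posL F (a x)) (pos' := fun x => posL (F * Rr (symOf m)) (a x))
    (Y := fun x => posL F (ω x)) (Y' := fun x => posL (F * Rr (symOf m)) (ω x))
    (hP _) (hM _) (hMI _) hMIM (hnb _) hpos hY (hReps hr)
  rw [hPm] at h
  rw [h]
  exact hrep _ (hB _ F hF) _ hr

/-- ★ THE HOST-FORCE PAIRING ROW (251) `hhf` from representatives of the interior (near radii `Lh` constant on orbits). [folklore] -/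
theorem hf_of_reps {MIr : Finset ι} (hB : ∀ k, ∀ F ∈ B, F * Rr k ∈ B) (hP : ∀ k, Function.Injective (Pk k))
    (hM : ∀ k, M.image (Pk k) = M) (hMIM : MI ⊆ M) (hnbh : ∀ k, ∀ m ∈ MI, nbh (Pk k m) = (nbh m).image (Pk k))
    (ha : ∀ k, ∀ x ∈ M, a (Pk k x) = (Rr k).mulVec (a x)) (hω : ∀ k, ∀ x ∈ MI, ω (Pk k x) = (Rr k).mulVec (ω x))
    (hReps : MIr ⊆ MI) (hcov : ∀ m ∈ MI, rep m ∈ MIr ∧ Pk (symOf m) (rep m) = m) {δ : ℝ} {Lh : ι → ℝ}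
    (hLh : ∀ m ∈ MI, Lh m = Lh (rep m)) (hfTab : ι → ℝ)
    (hrep : ∀ F ∈ B, ∀ m₀ ∈ MIr, ⟪posL F (ω m₀), ∑ m' ∈ (M.erase m₀).filter (fun m' => m' ∈ nbh m₀),
        ljBondForce (posL F (a m₀) - posL F (a m'))⟫ + ‖posL F (ω m₀)‖ * psiTail δ (Lh m₀) ≤ hfTab m₀) :
    ∀ F ∈ B, ∀ m ∈ MI, ⟪posL F (ω m), ∑ m' ∈ (M.erase m).filter (fun m' => m' ∈ nbh m),
        ljBondForce (posL F (a m) - posL F (a m'))⟫ + ‖posL F (ω m)‖ * psiTail δ (Lh m) ≤ hfTab (rep m) := by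
  intro F hF m hm
  obtain ⟨hr, hPm⟩ := hcov m hm
  rw [hLh m hm]
  have hpos : ∀ x ∈ M, posL F (a (Pk (symOf m) x)) = posL (F * Rr (symOf m)) (a x) := fun x hx => by
    rw [ha _ x hx, posL_mulVec_right]
  have hY : ∀ x ∈ MI, posL F (ω (Pk (symOf m) x)) = posL (F * Rr (symOf m)) (ω x) := fun x hx => by
    rw [hω _ x hx, posL_mulVec_right]
  have h := hostPair_symm (pos := fun x => posL F (a x)) (pos' := fun x => posL (F * Rr (symOf m)) (a x))
    (Y := fun x => posL F (ω x)) (Y' := fun x => posL (F * Rr (symOf m)) (ω x))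
    (hP _) (hM _) hMIM (hnbh _) hpos hY (hReps hr) (psiTail δ (Lh (rep m)))
  rw [hPm] at h
  rw [h]
  exact hrep _ (hB _ F hF) _ hr

omit [DecidableEq ι] in
/-- the far-column row (251) `hfc` from representatives of the interior. [folklore] -/
theorem fc_of_reps {MIr : Finset ι} (hB : ∀ k, ∀ F ∈ B, F * Rr k ∈ B) (hMIM : MI ⊆ M)
    (ha : ∀ k, ∀ x ∈ M, a (Pk k x) = (Rr k).mulVec (a x)) (hω : ∀ k, ∀ x ∈ MI, ω (Pk k x) = (Rr k).mulVec (ω x))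
    (hReps : MIr ⊆ MI) (hcov : ∀ m ∈ MI, rep m ∈ MIr ∧ Pk (symOf m) (rep m) = m) {Rc τ : ℝ} (fcTab : ι → ℝ)
    (hrep : ∀ F ∈ B, ∀ m₀ ∈ MIr, ‖posL F (ω m₀)‖ * farCol (Rc - (‖posL F (a m₀)‖ + τ)) ≤ fcTab m₀) :
    ∀ F ∈ B, ∀ m ∈ MI, ‖posL F (ω m)‖ * farCol (Rc - (‖posL F (a m)‖ + τ)) ≤ fcTab (rep m) := by
  intro F hF m hm
  obtain ⟨hr, hPm⟩ := hcov m hm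
  have h1 : posL F (ω m) = posL (F * Rr (symOf m)) (ω (rep m)) := by
    conv_lhs => rw [← hPm]
    rw [hω _ _ (hReps hr), posL_mulVec_right]
  have h2 : posL F (a m) = posL (F * Rr (symOf m)) (a (rep m)) := by
    conv_lhs => rw [← hPm]
    rw [ha _ _ (hMIM (hReps hr)), posL_mulVec_right]
  rw [h1, h2]
  exact hrep _ (hB _ F hF) _ hr

end Reps

/-! ## §6. The own-multiplier sum is ONE matrix per cell (translation lever; Bravais templates) -/

/-- the linearised bond map as a MATRIX in the multiplier: `linLab G z y = lamMat G z · y`. -/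
def lamMat (G : Matrix (Fin 3) (Fin 3) ℝ) (z : Fin 3 → ℝ) : Matrix (Fin 3) (Fin 3) ℝ :=
  fun i k => (if i = k then psiT (gram G z z) else 0) + 2 * psiT1 (gram G z z) * z i * ∑ j, G j k * z j

/-- `linLab` is linear in the multiplier with matrix `lamMat`. [folklore] -/
theorem linLab_eq_lamMat_mulVec (G : Matrix (Fin 3) (Fin 3) ℝ) (z y : Fin 3 → ℝ) : linLab G z y = (lamMat G z).mulVec y := by
  funext i
  simp only [linLab, lamMat, Matrix.mulVec, dotProduct, Pi.add_apply, Pi.smul_apply, smul_eq_mul, add_mul,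
    Finset.sum_add_distrib, ite_mul, zero_mul, Finset.sum_ite_eq, Finset.mem_univ, if_true]
  congr 1
  simp only [gram, Finset.mul_sum, Finset.sum_mul]
  rw [Finset.sum_comm]
  refine Finset.sum_congr rfl fun j _ => Finset.sum_congr rfl fun k _ => ?_
  ring

/-- ★ the own-multiplier sum of an interior label collapses to ONE matrix times its multiplier: `Σ_{x∈S} linLab G (f x) y =
(Σ_{x∈S} lamMat G (f x)) · y` — for a Bravais template the difference set `{a m − a m'}` of an interior label is the same for every
label, so the bracket is enclosed once per cell. [folklore] -/
theorem sum_linLab_eq {α : Type*} (G : Matrix (Fin 3) (Fin 3) ℝ) (S : Finset α) (f : α → Fin 3 → ℝ) (y : Fin 3 → ℝ) :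
    ∑ x ∈ S, linLab G (f x) y = (∑ x ∈ S, lamMat G (f x)).mulVec y := by
  rw [Matrix.sum_mulVec]
  exact Finset.sum_congr rfl fun x _ => linLab_eq_lamMat_mulVec G (f x) y

end Summit.AtomisticToContinuum.Crystallization.Theorems.FrustratedLawDichotomyCellSymm

end
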